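import Literature.LinearAlgebra.Alternating.ExteriorAlgebraSpinorRepresentation
import Literature.Algebra.Lie.OrthogonalAlgebraSimple
import Literature.Algebra.Lie.SplitOrthogonalFourIdeals
import Literature.Algebra.Lie.OrthogonalSelfAdjointIrreducibleTypeD
import Literature.Algebra.Lie.OrthogonalSemisimpleTypeDTwo
import Literature.Algebra.Lie.SplitOrthogonalFourStableSubspaces
import HarnessLib

/-!
# `𝔰𝔬(V ⊕ V^*)` is a simple real Lie algebra IFF `dim V ≥ 3` (Looijenga–Lunts 1997, §3 (3.1)–(3.3): "`(𝔰𝔬(V ⊕ V^*), u)` is a Jordan–Lefschetz pair — a real form of `(D_{2n}, A_{2n-1})`"; Humphreys: `D_ℓ` is simple exactly for `ℓ ≥ 3`)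

Topic `Literature/LinearAlgebra/Alternating` (namespace `Literature.LinearAlgebra.Alternating`, next to row A1-43's
`ExteriorAlgebraSpinorRepresentation.lean`, whose `sumDual V = V × (V →L[ℝ] ℝ)`, `splitForm V` and
`so V = skewAdjointLieSubalgebra (splitForm V)` are used BY NAME).  Lane `lit-hodgefound` (Track 2 foundations
library), Layer A1 «complex tori · H^k = ⋀^k H¹», skeleton seat `lit-hodgefound-skel-1` (generation 50), row **A1-173**
of `run/shared/lean/pub/lit-hodgefound/SKELETON.md`.  THEOREMS ONLY; no definition, no named fact, no `sorry` (net
debt `0`); `LieRing.ofAssociativeRing` only by `letI` inside proofs.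

It DISCHARGES the "TODO(general form): any real `V`, `dim V ≥ 3`" of row A1-51
(`Geometry/Kaehler/ComplexTorusTotalLieAlgebraSimple.lean`, faithfulness note 2), whose `isSimple_so` needs `V = E_ℝ`
for a COMPLEX normed space `E` with `dim_ℂ E ≥ 2` (its root vectors are typed over `E`): here `V` is any
finite-dimensional real normed space with `dim_ℝ V ≥ 3` (`𝔰𝔬(3, 3) = D_3` included), and the proof is the transport
of the tree's matrix theorem "`𝔬(2l, K)` is simple" (`Algebra/Lie/OrthogonalSimpleTypeD.lean`, rows A1-168/169) through
the split-form theorem of `Algebra/Lie/OrthogonalAlgebraSimple.lean` (row A1-172,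
`eq_bot_or_eq_of_forall_lie_mem_of_toMatrix_eq_JD`) and the hyperbolic basis `(c_i, 0), (0, c^i)` of `V ⊕ V^*`.

## Sources, VERBATIM (held TeX `paper:arxiv-alg-geom_9604014`)

* (3.1) p0012–p0013: "Let `V` be a real finite dimensional vector space. […]" — the split quadratic form `q(x, ξ) = ξ(x)` on
  `V ⊕ V^*` and `𝔰𝔬(V ⊕ V^*)`; p0013 L79–L81: "The pair `(𝔰𝔬(V ⊕ V^*), u)` is a Jordan–Lefschetz pair (it is a real
  form of case `(D_{2n}, A_{2n-1})`)."; (3.3) p0013 L109–L112: "There is a natural identification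
  `(𝔤_tot(X; ℝ), h) ≅ (𝔰𝔬(V^* ⊕ V), u)`".  A (Jordan–)Lefschetz pair has `𝔤` semisimple by definition (§2 p0007
  L55–L78); this file proves the sharper "simple" for `dim V ≥ 3`.
* J. E. Humphreys, GTM 9, §1.2 p. 4 (the form `s = (0 I; I 0)` of `D_ℓ`), §19.2 p. 102 ("the classical algebras are …
  simple"); B. C. Hall, GTM 222, Cor. 8.47 ("the even orthogonal algebras `so(2n; ℂ)`, `n ≥ 3`") and Prop. 7.31;
  for the exception `dim V = 2`: LL Appendix (7.5) p0028 L89–L90 ("except when `U` is an inner product space of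
  dimension 4") and Fulton–Harris §18.2 (18.6) (`𝔰𝔬₄ℂ ≅ 𝔰𝔩₂ℂ × 𝔰𝔩₂ℂ`), both already formalised in row A1-165's
  `SplitOrthogonalFourIdeals.lean` and only USED here.

## Contents (all proved)

* `toMatrix_splitForm_eq_JD` — in the basis `c.prod (c.dualBasis.map LinearMap.toContinuousLinearMap)` of `V ⊕ V^*`
  the split form has Gram matrix `JD ι ℝ = (0 I; I 0)`;
* `splitForm_eq_bot_or_eq_of_forall_lie_mem` — every `ad(𝔰𝔬(V ⊕ V^*))`-stable real subspace of `𝔰𝔬(V ⊕ V^*)` is `0` or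
  everything (`dim V ≥ 3`); `mem_so_iff_mem_skewAdjointSubmodule`;
* `eq_bot_or_eq_top_of_lieIdeal_so`, `so_non_abelian` (`dim V ≥ 2`; `[p_{uv}, n_{uv}] = h_u + h_v ≠ 0` pulled back),
  **`isSimple_so_of_finrank : LieAlgebra.IsSimple ℝ (so V)`** (`3 ≤ finrank ℝ V`), `isSemisimple_so_of_finrank`,
  `hasTrivialRadical_so_of_finrank`, `center_so_eq_bot_of_finrank`;
* sharpness: `finrank_sumDual` (`= 2 dim V`), `splitForm_flip`, `finrank_skewAdjointSubmodule_splitForm` and `finrank_so`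
  (`dim 𝔰𝔬(V ⊕ V^*) = C(2 dim V, 2)`, row A1-164), `so_isLieAbelian_of_finrank_le_one`, `so_isLieAbelian_iff`
  (`↔ dim V ≤ 1`), `not_isSimple_so_of_finrank_eq_two` (row A1-165's proper stable subspace of the split inner product
  `4`-space algebra `𝔰𝔬(2,2) = I_+ ⊕ I_-` is a proper non-zero Lie ideal — the dimension-`4` exception of LL (7.5)),
  `not_isSimple_so_of_finrank_le_two`, and **`isSimple_so_iff : LieAlgebra.IsSimple ℝ (so V) ↔ 3 ≤ finrank ℝ V`**.
* rider A1-177 (Looijenga–Lunts (7.5) on `V ⊕ V^*`): `splitForm_isInternal_skew_scalar_symm`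
  (`𝔤𝔩(V ⊕ V^*) = 𝔰𝔬 ⊕ ℝ·1 ⊕ 𝔤_+`, row A1-157), **`splitForm_selfAdjoint_eq_bot_or_eq_of_forall_lie_mem`** /
  `…_of_forall_so_lie_mem` (the traceless `S`-self-adjoint summand `𝔤_+ ≅ Sym²₀(V ⊕ V^*)` has no proper non-zero
  `ad(𝔰𝔬(V ⊕ V^*))`-stable real subspace for `dim V ≥ 2` — rows A1-174/175 in the hyperbolic basis),
  `exists_ne_zero_mem_splitForm_selfAdjoint`, `splitForm_span_lie_selfAdjoint_eq_skewAdjointSubmodule`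
  (`[𝔤_+, 𝔤_+] = 𝔰𝔬(V ⊕ V^*)`, `dim V ≥ 2`, row A1-161).
* rider A1-181 (`dim V = 2`, row A1-180 `OrthogonalSemisimpleTypeDTwo` in the hyperbolic basis):
  **`hasTrivialRadical_so_of_finrank_eq_two`**, **`isSemisimple_so_of_finrank_eq_two`** (`𝔰𝔬(2,2) = D_2` is semisimple,
  not simple), `isSemisimple_so_of_two_le_finrank`, `hasTrivialRadical_so_of_two_le_finrank`,
  `center_so_eq_bot_of_two_le_finrank` (the printed clause "`𝔤` semisimple" of the Jordan–Lefschetz pair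
  `(𝔰𝔬(V ⊕ V^*), u)` for every `dim V ≥ 2`), `not_isSemisimple_so_of_finrank_eq_one`, `isSemisimple_so_of_finrank_eq_zero`,
  **`isSemisimple_so_iff`** (`𝔰𝔬(V ⊕ V^*)` is semisimple iff `dim V ≠ 1`).
* rider A1-182 (`dim V = 1`, row A1-167 in the reindexed hyperbolic basis): `exists_basis_toMatrix_splitForm_eq_of_finrank_eq_one`
  (Gram `!![0, 1; 1, 0]`), **`exists_proper_stable_submodule_splitForm_selfAdjoint_of_finrank_eq_one`** (`𝔤_+` of the
  hyperbolic plane is reducible — the excluded case of (7.5)), `not_forall_splitForm_selfAdjoint_eq_bot_or_eq_of_finrank_eq_one`,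
  `submodule_end_sumDual_eq_bot_of_finrank_eq_zero`, **`forall_splitForm_selfAdjoint_eq_bot_or_eq_iff`** (`𝔤_+(V ⊕ V^*)` is
  `ad(𝔰𝔬)`-irreducible iff `dim V ≠ 1`).
* rider A1-184 (`dim V = 2`, row A1-183): `exists_basis_toMatrix_splitForm_eq_of_finrank_eq_two`,
  **`splitForm_stable_submodule_classification_of_finrank_eq_two`** (the `ad`-stable subspaces of `𝔰𝔬(2,2)` are exactly
  `0`, `I_+`, `I_-`, `𝔰𝔬(2,2)`), `splitForm_exists_commuting_minimal_ideals_of_finrank_eq_two` (`I_±` minimal),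
  `splitForm_finrank_eq_three_of_stable_of_finrank_eq_two`.
* rider A1-186 (`dim V = 2`, row A1-185, Lie ideals of `so V`): **`so_lieIdeal_classification_of_finrank_eq_two`**
  (the Lie ideals of `𝔰𝔬(2,2)` are `⊥, I₁, I₂, ⊤`, `I₁, I₂` commuting atoms), **`so_exists_isSimple_ideals_of_finrank_eq_two`**
  (`I₁, I₂` simple: `𝔰𝔬(2,2) ≅ 𝔰𝔩₂(ℝ) × 𝔰𝔩₂(ℝ)` up to the unconstructed isomorphism), `so_isSimple_lieIdeal_of_finrank_eq_two`.

## Scope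

The torus-side restatement (`𝔤_tot(X; ℝ)` simple for `g ≥ 2`) is already row A1-51's `isSimple_totalLieAlgebra` and is
not repeated; the
last clause of (7.5) ("there exists `Y ∈ 𝔤_ε(U)` …") is row A1-162's and is not restated for `V ⊕ V^*`.  Nothing here
is a case of the Hodge conjecture.

## References

* [LooijengaLunts1997] E. Looijenga, V. A. Lunts, Invent. Math. 129 (1997) 361–412, §2 p. 7, §3 (3.1)–(3.3) p. 13,
  Appendix Lemma (7.5) p. 28.
* [Humphreys1972] J. E. Humphreys, GTM 9, Springer 1972, §1.2 p. 4, §19.2 p. 102.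
* [Hall2015] B. C. Hall, GTM 222, 2nd ed., Springer 2015, Corollary 8.47, Proposition 7.31.
* [FultonHarris1991] W. Fulton, J. Harris, GTM 129, Springer 1991, §18.2, (18.6), p. 274 (`𝔰𝔬₄ ≅ 𝔰𝔩₂ × 𝔰𝔩₂`).
-/

-- `open` at root scope: inside the namespace, `open Matrix` would resolve to `Literature.LinearAlgebra.Matrix`.
open Module Matrix Sum LieAlgebra.Orthogonal
open Literature.Algebra.Lie

namespace Literature.LinearAlgebra.Alternating

variable (V : Type*) [NormedAddCommGroup V] [NormedSpace ℝ V] [FiniteDimensional ℝ V]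

/-- **A hyperbolic basis of `V ⊕ V^*` from any basis of `V`**: in the basis `(c_i, 0)`, `(0, c^i)` (`c^i` the dual
basis, as continuous functionals) the split form `S((a, α), (b, β)) = α(b) + β(a)` has Gram matrix `JD ι ℝ = (0 I; I 0)`
— Humphreys' `s` for `D_ℓ`. [cite: LooijengaLunts1997, §3 (3.1) and (3.3) ("a real form of the case (D_{2n}, A_{2n-1})"); Humphreys1972, §1.2, p. 4 (type D_ℓ, s = (0 I; I 0))] -/
theorem toMatrix_splitForm_eq_JD {ι : Type*} [Fintype ι] [DecidableEq ι] (c : Basis ι ℝ V) :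
    LinearMap.BilinForm.toMatrix (c.prod (c.dualBasis.map LinearMap.toContinuousLinearMap)) (splitForm V)
      = JD ι ℝ := by
  ext p q
  rw [LinearMap.BilinForm.toMatrix_apply, splitForm_apply, JD]
  rcases p with i | i <;> rcases q with j | j
  · simp only [Basis.prod_apply_inl_fst, Basis.prod_apply_inl_snd, _root_.zero_apply, add_zero,
      fromBlocks_apply₁₁, Matrix.zero_apply]
  · simp only [Basis.prod_apply_inl_fst, Basis.prod_apply_inl_snd, Basis.prod_apply_inr_fst, Basis.prod_apply_inr_snd,
      _root_.zero_apply, zero_add, Basis.map_apply, LinearMap.coe_toContinuousLinearMap',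
      Basis.dualBasis_apply_self, fromBlocks_apply₁₂, Matrix.one_apply]
  · simp only [Basis.prod_apply_inl_fst, Basis.prod_apply_inl_snd, Basis.prod_apply_inr_fst, Basis.prod_apply_inr_snd,
      _root_.zero_apply, add_zero, Basis.map_apply, LinearMap.coe_toContinuousLinearMap',
      Basis.dualBasis_apply_self, fromBlocks_apply₂₁, Matrix.one_apply]
    split_ifs with h1 h2 h2
    · rfl
    · exact absurd h1.symm h2
    · exact absurd h2.symm h1
    · rfl
  · simp only [Basis.prod_apply_inr_fst, Basis.prod_apply_inr_snd, map_zero, add_zero, fromBlocks_apply₂₂,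
      Matrix.zero_apply]

/-- **`𝔰𝔬(V ⊕ V^*)` is ideal-free for every real `V` of dimension `≥ 3`**: every real subspace
`P ⊆ 𝔰𝔬(V ⊕ V^*) = (splitForm V).skewAdjointSubmodule` stable under all `X ↦ [a, X]`, `a ∈ 𝔰𝔬(V ⊕ V^*)`, is `0` or
everything — row A1-51's "TODO(general form): any real `V`, `dim V ≥ 3`", via the split-form theorem of
`OrthogonalAlgebraSimple.lean` (rider A1-172) and the hyperbolic basis above.
[cite: LooijengaLunts1997, §3 p. 13 (after (3.2)) and (3.3); Humphreys1972, §19.2, p. 102 (type D_ℓ); Hall2015, Cor. 8.47] -/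
theorem splitForm_eq_bot_or_eq_of_forall_lie_mem (h3 : 3 ≤ finrank ℝ V)
    {P : Submodule ℝ (Module.End ℝ (sumDual V))} (hP : P ≤ (splitForm V).skewAdjointSubmodule)
    (hstab : ∀ a ∈ (splitForm V).skewAdjointSubmodule, ∀ x ∈ P, ⁅a, x⁆ ∈ P) :
    P = ⊥ ∨ P = (splitForm V).skewAdjointSubmodule := by
  classical
  let c := Module.finBasis ℝ V
  refine OrthogonalAlgebraSimple.eq_bot_or_eq_of_forall_lie_mem_of_toMatrix_eq_JD
    (c.prod (c.dualBasis.map LinearMap.toContinuousLinearMap)) (toMatrix_splitForm_eq_JD V c) ?_ hP hstab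
  rwa [Fintype.card_fin]

omit [FiniteDimensional ℝ V] in
/-- `x ∈ 𝔰𝔬(V ⊕ V^*) = so V ↔ x ∈ (splitForm V).skewAdjointSubmodule` (definitional). [cite: LooijengaLunts1997, §3 (3.1)] -/
theorem mem_so_iff_mem_skewAdjointSubmodule (x : Module.End ℝ (sumDual V)) :
    x ∈ so V ↔ x ∈ (splitForm V).skewAdjointSubmodule :=
  Iff.rfl

/-- **Every Lie ideal of `𝔰𝔬(V ⊕ V^*)` is `⊥` or `⊤`** for every real `V` with `dim V ≥ 3`.
[cite: LooijengaLunts1997, §3 p. 13 (after (3.2)) and (3.3); Humphreys1972, §19.2, p. 102 (type D_ℓ); Hall2015, Cor. 8.47] -/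
theorem eq_bot_or_eq_top_of_lieIdeal_so (h3 : 3 ≤ finrank ℝ V) (I : LieIdeal ℝ (so V)) : I = ⊥ ∨ I = ⊤ := by
  classical
  letI : LieRing (Module.End ℝ (sumDual V)) := LieRing.ofAssociativeRing
  letI : LieAlgebra ℝ (Module.End ℝ (sumDual V)) := LieAlgebra.ofAssociativeAlgebra
  set P : Submodule ℝ (Module.End ℝ (sumDual V)) := (I : Submodule ℝ (so V)).map (so V).toSubmodule.subtype
    with hPdef
  have hPmem : ∀ {m : Module.End ℝ (sumDual V)}, m ∈ P ↔ ∃ hm : m ∈ so V, (⟨m, hm⟩ : so V) ∈ I := by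
    intro m
    rw [hPdef, Submodule.mem_map]
    constructor
    · rintro ⟨y, hy, rfl⟩
      exact ⟨y.2, hy⟩
    · rintro ⟨hm, hmI⟩
      exact ⟨⟨m, hm⟩, hmI, rfl⟩
  have hP : P ≤ (splitForm V).skewAdjointSubmodule := fun m hm ↦ (hPmem.1 hm).1
  have hstab : ∀ a ∈ (splitForm V).skewAdjointSubmodule, ∀ x ∈ P, ⁅a, x⁆ ∈ P := by
    intro a ha x hx
    obtain ⟨hx, hxI⟩ := hPmem.1 hx
    have h := I.lie_mem (x := (⟨a, ha⟩ : so V)) hxI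
    exact hPmem.2 ⟨_, h⟩
  rcases splitForm_eq_bot_or_eq_of_forall_lie_mem V h3 hP hstab with hbot | hall
  · left
    rw [eq_bot_iff]
    intro m hm
    rw [LieSubmodule.mem_bot]
    have hmP : (m : Module.End ℝ (sumDual V)) ∈ P := hPmem.2 ⟨m.2, hm⟩
    rw [hbot, Submodule.mem_bot] at hmP
    exact Subtype.ext hmP
  · right
    rw [eq_top_iff]
    rintro y -
    have hy : (y : Module.End ℝ (sumDual V)) ∈ P := by rw [hall]; exact y.2
    obtain ⟨_, hyI⟩ := hPmem.1 hy
    exact hyI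

/-- **`𝔰𝔬(V ⊕ V^*)` is not abelian** for `dim V ≥ 2`: in a hyperbolic basis, `[p_{uv}, n_{uv}] = h_u + h_v ≠ 0`
(row A1-168's bracket table, pulled back through `X ↦ [X]_b`). [cite: LooijengaLunts1997, §3 (3.3); Humphreys1972, §1.2, §19.2] -/
theorem so_non_abelian (h2 : 2 ≤ finrank ℝ V) : ¬IsLieAbelian (so V) := by
  classical
  letI : LieRing (Module.End ℝ (sumDual V)) := LieRing.ofAssociativeRing
  letI : LieAlgebra ℝ (Module.End ℝ (sumDual V)) := LieAlgebra.ofAssociativeAlgebra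
  let c := Module.finBasis ℝ V
  let b := c.prod (c.dualBasis.map LinearMap.toContinuousLinearMap)
  have hb := toMatrix_splitForm_eq_JD V c
  have hmem : ∀ X : Module.End ℝ (sumDual V), X ∈ so V ↔ LinearMap.toMatrix b b X ∈ typeD (Fin (finrank ℝ V)) ℝ := by
    intro X
    rw [mem_so_iff_mem_skewAdjointSubmodule, SymplecticAlgebraSimple.mem_skewAdjointSubmodule_iff_isSkewAdjoint_toMatrix b,
      hb, OrthogonalSimpleTypeD.isSkewAdjoint_JD_iff_mem_typeD]
  let u : Fin (finrank ℝ V) := ⟨0, by omega⟩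
  let v : Fin (finrank ℝ V) := ⟨1, by omega⟩
  have huv : u ≠ v := by simp [u, v, Fin.ext_iff]
  let Φ := LinearMap.toMatrix b b
  -- `p_{uv}` and `n_{uv}` pulled back to `End(V ⊕ V^*)`
  let X := Φ.symm (single (inr u) (inl v) (1 : ℝ) - single (inr v) (inl u) 1)
  let Y := Φ.symm (single (inl u) (inr v) (1 : ℝ) - single (inl v) (inr u) 1)
  have hX : X ∈ so V := by
    rw [hmem, LinearEquiv.apply_symm_apply]
    exact OrthogonalSimpleTypeD.single_inr_inl_sub_mem_typeD u v
  have hY : Y ∈ so V := by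
    rw [hmem, LinearEquiv.apply_symm_apply]
    exact OrthogonalSimpleTypeD.single_inl_inr_sub_mem_typeD u v
  intro h
  have hc := h.trivial ⟨X, hX⟩ ⟨Y, hY⟩
  have hc' := congrArg (fun Z : so V ↦ Φ (Z : Module.End ℝ (sumDual V))) hc
  simp only [LieSubalgebra.coe_bracket, ZeroMemClass.coe_zero, map_zero, Ring.lie_def, map_sub] at hc'
  rw [LinearMap.toMatrix_mul, LinearMap.toMatrix_mul] at hc'
  simp only [Φ, X, Y, LinearEquiv.apply_symm_apply, OrthogonalSimpleTypeD.psub_comm_nsub huv] at hc'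
  have h11 := congrFun (congrFun hc' (inl u)) (inl u)
  have hvu : v ≠ u := huv.symm
  simp [hvu] at h11

/-- **`𝔰𝔬(V ⊕ V^*)` IS A SIMPLE REAL LIE ALGEBRA for every finite-dimensional real `V` with `dim V ≥ 3`** — the general
form of row A1-51's `isSimple_so` (there: `V = E_ℝ` for a complex `E`, `dim_ℂ E ≥ 2`): the clause "`𝔤` semisimple" of
"the pair `(𝔰𝔬(V ⊕ V^*), u)` is a Jordan–Lefschetz pair (a real form of case `(D_{2n}, A_{2n-1})`)", sharpened to
simple, for the split real form `𝔰𝔬(n, n)`, `n ≥ 3`. [cite: LooijengaLunts1997, §3 p. 13 (after (3.2)) and (3.3); Humphreys1972, §19.2, p. 102 (type D_ℓ); Hall2015, Cor. 8.47 and Prop. 7.31] -/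
theorem isSimple_so_of_finrank (h3 : 3 ≤ finrank ℝ V) : LieAlgebra.IsSimple ℝ (so V) :=
  ⟨eq_bot_or_eq_top_of_lieIdeal_so V h3, so_non_abelian V (by omega)⟩

/-- `𝔰𝔬(V ⊕ V^*)` is semisimple for `dim V ≥ 3` (so `𝔤_tot(X; ℝ)` of a complex torus of dimension `g ≥ 2` is,
through row A1-43's `totalLieAlgebraEquiv`). [cite: LooijengaLunts1997, (1.9) and §3 (3.3)] -/
theorem isSemisimple_so_of_finrank (h3 : 3 ≤ finrank ℝ V) : LieAlgebra.IsSemisimple ℝ (so V) :=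
  @LieAlgebra.IsSimple.instIsSemisimple ℝ (so V) _ _ _ (isSimple_so_of_finrank V h3)

/-- `𝔰𝔬(V ⊕ V^*)` has trivial radical for `dim V ≥ 3`. [cite: LooijengaLunts1997, §3 (3.3)] -/
theorem hasTrivialRadical_so_of_finrank (h3 : 3 ≤ finrank ℝ V) : LieAlgebra.HasTrivialRadical ℝ (so V) :=
  @LieAlgebra.IsSemisimple.instHasTrivialRadical ℝ (so V) _ _ _ (isSemisimple_so_of_finrank V h3)

/-- `𝔰𝔬(V ⊕ V^*)` has trivial centre for `dim V ≥ 3`. [cite: LooijengaLunts1997, §3 (3.3)] -/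
theorem center_so_eq_bot_of_finrank (h3 : 3 ≤ finrank ℝ V) : LieAlgebra.center ℝ (so V) = ⊥ := by
  have h := hasTrivialRadical_so_of_finrank V h3
  exact le_bot_iff.mp ((LieAlgebra.center_le_radical ℝ (so V)).trans_eq h.radical_eq_bot)

/-! ## Sharpness: `dim V ≤ 2`

`dim 𝔰𝔬(V ⊕ V^*) = C(2·dim V, 2)` (row A1-164); for `dim V ≤ 1` the algebra is abelian, for `dim V = 2` it is the split
inner product `4`-space algebra `𝔰𝔬(2,2) = I_+ ⊕ I_-` of row A1-165 (two commuting `3`-dimensional ideals), so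
`isSimple_so_of_finrank` is sharp: **`𝔰𝔬(V ⊕ V^*)` is simple iff `dim V ≥ 3`**. -/

/-- `dim (V ⊕ V^*) = 2 · dim V`. [cite: LooijengaLunts1997, §3 (3.1)] -/
theorem finrank_sumDual : finrank ℝ (sumDual V) = 2 * finrank ℝ V := by
  classical
  rw [finrank_eq_card_basis ((Module.finBasis ℝ V).prod
    ((Module.finBasis ℝ V).dualBasis.map LinearMap.toContinuousLinearMap)), Fintype.card_sum, Fintype.card_fin, two_mul]

omit [FiniteDimensional ℝ V] in
/-- The split form is symmetric: `S.flip = S`. [cite: LooijengaLunts1997, §3 (3.1)] -/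
theorem splitForm_flip : (splitForm V).flip = splitForm V :=
  LinearMap.ext₂ fun x y ↦ (splitForm_isSymm V).eq y x

/-- **`dim 𝔰𝔬(V ⊕ V^*) = C(2·dim V, 2)`** (`= 2ℓ² - ℓ`, `ℓ = dim V`: Humphreys' count for `D_ℓ`), from row A1-164's
basis-free `dim 𝔰𝔬(U, B) = C(dim U, 2)`. [cite: Humphreys1972, §1.2, p. 4 (type D_ℓ: dimension 2ℓ² - ℓ); LooijengaLunts1997, §3 (3.1)] -/
theorem finrank_skewAdjointSubmodule_splitForm :
    finrank ℝ (splitForm V).skewAdjointSubmodule = (2 * finrank ℝ V).choose 2 := by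
  rw [OrthogonalDimension.finrank_skewAdjointSubmodule_of_flip_eq (splitForm V) (splitForm_nondegenerate V)
    (splitForm_flip V), finrank_sumDual]

/-- `dim so V = C(2·dim V, 2)` (the same count on the Lie subalgebra `so V`). [cite: Humphreys1972, §1.2, p. 4 (type D_ℓ)] -/
theorem finrank_so : finrank ℝ (so V) = (2 * finrank ℝ V).choose 2 :=
  finrank_skewAdjointSubmodule_splitForm V

/-- For `dim V ≤ 1`, `𝔰𝔬(V ⊕ V^*)` has dimension `≤ 1`, hence is abelian (`𝔰𝔬(1,1) ≅ ℝ`, `𝔰𝔬(0,0) = 0`). [cite: Humphreys1972, §1.2, p. 4 (type D_ℓ, ℓ ≤ 1)] -/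
theorem so_isLieAbelian_of_finrank_le_one (h1 : finrank ℝ V ≤ 1) : IsLieAbelian (so V) := by
  letI : LieRing (Module.End ℝ (sumDual V)) := LieRing.ofAssociativeRing
  letI : LieAlgebra ℝ (Module.End ℝ (sumDual V)) := LieAlgebra.ofAssociativeAlgebra
  have hle : finrank ℝ (splitForm V).skewAdjointSubmodule ≤ 1 := by
    rw [finrank_skewAdjointSubmodule_splitForm]
    rcases (by omega : finrank ℝ V = 0 ∨ finrank ℝ V = 1) with h | h <;> rw [h] <;> decide
  obtain ⟨g, hg⟩ := (Submodule.finrank_le_one_iff_isPrincipal (K := ℝ) (V := Module.End ℝ (sumDual V))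
    (splitForm V).skewAdjointSubmodule).1 hle
  refine ⟨fun x y ↦ ?_⟩
  have hx : (x : Module.End ℝ (sumDual V)) ∈ (splitForm V).skewAdjointSubmodule := x.2
  have hy : (y : Module.End ℝ (sumDual V)) ∈ (splitForm V).skewAdjointSubmodule := y.2
  rw [hg, Submodule.mem_span_singleton] at hx hy
  obtain ⟨a, ha⟩ := hx
  obtain ⟨b, hb⟩ := hy
  apply Subtype.ext
  rw [LieSubalgebra.coe_bracket, ZeroMemClass.coe_zero, Ring.lie_def, ← ha, ← hb, smul_mul_smul_comm, smul_mul_smul_comm,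
    mul_comm b a, sub_self]

/-- `𝔰𝔬(V ⊕ V^*)` is abelian iff `dim V ≤ 1`. [cite: Humphreys1972, §1.2, p. 4 (type D_ℓ)] -/
theorem so_isLieAbelian_iff : IsLieAbelian (so V) ↔ finrank ℝ V ≤ 1 :=
  ⟨fun h ↦ by
    by_contra h'
    exact so_non_abelian V (by omega) h, so_isLieAbelian_of_finrank_le_one V⟩

/-- **For `dim V = 2`, `𝔰𝔬(V ⊕ V^*) = 𝔰𝔬(2,2)` is NOT simple**: row A1-165's proper non-zero `ad`-stable subspace of the
split inner product `4`-space algebra (`𝔰𝔬₄ ≅ 𝔰𝔩₂ × 𝔰𝔩₂`, one of the two commuting ideals `I_±`) is a proper non-zero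
Lie ideal — the dimension-`4` exception of Looijenga–Lunts (7.5). [cite: LooijengaLunts1997, Appendix Lemma (7.5), p. 28 L89–L90 ("except when U is an inner product space of dimension 4"); FultonHarris1991, §18.2, (18.6), p. 274] -/
theorem not_isSimple_so_of_finrank_eq_two (h2 : finrank ℝ V = 2) : ¬LieAlgebra.IsSimple ℝ (so V) := by
  classical
  letI : LieRing (Module.End ℝ (sumDual V)) := LieRing.ofAssociativeRing
  letI : LieAlgebra ℝ (Module.End ℝ (sumDual V)) := LieAlgebra.ofAssociativeAlgebra
  let c : Basis (Fin 2) ℝ V := Module.finBasisOfFinrankEq ℝ V h2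
  have hb : LinearMap.BilinForm.toMatrix (c.prod (c.dualBasis.map LinearMap.toContinuousLinearMap)) (splitForm V)
      = Matrix.fromBlocks 0 1 1 0 :=
    toMatrix_splitForm_eq_JD V c
  obtain ⟨I, hI0, hIlt, hIstab⟩ := SplitOrthogonalFour.exists_proper_stable_submodule_skewAdjointSubmodule hb
  -- the Lie ideal `I ∩ 𝔰𝔬` seen inside `so V`
  let J : LieIdeal ℝ (so V) :=
    { I.comap (so V).toSubmodule.subtype with
      lie_mem := fun {a m} hm ↦ hIstab a a.2 m hm }
  have hJmem : ∀ {m : so V}, m ∈ J ↔ (m : Module.End ℝ (sumDual V)) ∈ I := Iff.rfl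
  intro hS
  rcases hS.eq_bot_or_eq_top J with hJ | hJ
  · apply hI0
    rw [eq_bot_iff]
    intro m hm
    have hmJ : (⟨m, hIlt.le hm⟩ : so V) ∈ J := hJmem.2 hm
    rw [hJ, LieSubmodule.mem_bot] at hmJ
    rw [Submodule.mem_bot]
    exact congrArg Subtype.val hmJ
  · apply hIlt.ne (le_antisymm hIlt.le fun m hm ↦ ?_)
    have hmJ : (⟨m, hm⟩ : so V) ∈ J := by
      rw [hJ]
      exact LieSubmodule.mem_top _
    exact hJmem.1 hmJ

/-- For `dim V ≤ 2`, `𝔰𝔬(V ⊕ V^*)` is not simple (abelian for `dim V ≤ 1`, `𝔰𝔬(2,2) ≅ 𝔰𝔩₂ × 𝔰𝔩₂` for `dim V = 2`).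
[cite: LooijengaLunts1997, Appendix Lemma (7.5), p. 28 L89–L90; FultonHarris1991, §18.2, (18.6), p. 274] -/
theorem not_isSimple_so_of_finrank_le_two (h : finrank ℝ V ≤ 2) : ¬LieAlgebra.IsSimple ℝ (so V) := by
  rcases (by omega : finrank ℝ V ≤ 1 ∨ finrank ℝ V = 2) with h1 | h2
  · exact fun hS ↦ hS.non_abelian (so_isLieAbelian_of_finrank_le_one V h1)
  · exact not_isSimple_so_of_finrank_eq_two V h2

/-- **`𝔰𝔬(V ⊕ V^*)` is a simple real Lie algebra IFF `dim V ≥ 3`** (`D_ℓ` is simple exactly for `ℓ ≥ 3`: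
`D_1` abelian, `D_2 = A_1 × A_1`). [cite: Humphreys1972, §1.2 p. 4 and §19.2 p. 102 (type D_ℓ); FultonHarris1991, §18.2, (18.6); LooijengaLunts1997, §3 (3.1)–(3.3) and Appendix (7.5)] -/
theorem isSimple_so_iff : LieAlgebra.IsSimple ℝ (so V) ↔ 3 ≤ finrank ℝ V :=
  ⟨fun h ↦ by
    by_contra h'
    exact not_isSimple_so_of_finrank_le_two V (by omega) h, isSimple_so_of_finrank V⟩

/-! ## Looijenga–Lunts (7.5) on `V ⊕ V^*` (rider A1-177): `𝔤𝔩 = 𝔤_- ⊕ 𝔤_0 ⊕ 𝔤_+`, and the summand `𝔤_+` is `ad(𝔰𝔬)`-irreducible for `dim V ≥ 2`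

For the split form `S` on `V ⊕ V^*` the three-piece decomposition of (7.5) (`GlSelfAdjointDecomposition.lean`,
row A1-157), the irreducibility of the traceless `S`-self-adjoint summand `𝔤_+(V ⊕ V^*) = Sym²₀` under `𝔰𝔬(V ⊕ V^*)`
(rows A1-174/175 through the hyperbolic basis `toMatrix_splitForm_eq_JD`; `dim V ≥ 2` — `𝔰𝔬(2,2)` included, the
dimension-`4` exception of (7.5) concerns `𝔤_-` only), and `[𝔤_+, 𝔤_+] = 𝔤_-` (row A1-161). -/

/-- **`𝔤𝔩(V ⊕ V^*) = 𝔰𝔬(V ⊕ V^*) ⊕ ℝ·1 ⊕ 𝔤_+(V ⊕ V^*)`** for the split form (row A1-157's `isInternal_skew_scalar_symm`,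
`ε = 1`). [cite: LooijengaLunts1997, Appendix Lemma (7.5), p. 28 L86–L88; §3 (3.1) p. 13] -/
theorem splitForm_isInternal_skew_scalar_symm :
    DirectSum.IsInternal fun i : Fin 3 ↦
      ![(splitForm V).skewAdjointSubmodule, ℝ ∙ (1 : Module.End ℝ (sumDual V)),
        (splitForm V).selfAdjointSubmodule ⊓ LinearMap.ker (LinearMap.trace ℝ (sumDual V))] i :=
  isInternal_skew_scalar_symm (splitForm_nondegenerate V) (ε := 1) (fun u u' ↦ by rw [one_mul, (splitForm_isSymm V).eq])
    (one_mul 1)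

/-- **The summand `𝔤_+(V ⊕ V^*)` (traceless `S`-self-adjoint operators, `≅ Sym²₀(V ⊕ V^*)`) is `ad(𝔰𝔬(V ⊕ V^*))`-IRREDUCIBLE
for every real `V` with `dim V ≥ 2`**: every real subspace `P ⊆ 𝔤_+` stable under all `X ↦ [a, X]`, `a ∈ 𝔰𝔬(V ⊕ V^*)`, is
`⊥` or `𝔤_+` — rows A1-174/175's `eq_bot_or_eq_of_forall_lie_mem_of_toMatrix_eq_JD` in the hyperbolic basis.
[cite: LooijengaLunts1997, Appendix Lemma (7.5), p. 28 L88–L89 ("The summands are irreducible"); §3 (3.1)–(3.3) p. 13] -/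
theorem splitForm_selfAdjoint_eq_bot_or_eq_of_forall_lie_mem (h2 : 2 ≤ finrank ℝ V)
    {P : Submodule ℝ (Module.End ℝ (sumDual V))}
    (hP : P ≤ (splitForm V).selfAdjointSubmodule ⊓ LinearMap.ker (LinearMap.trace ℝ (sumDual V)))
    (hstab : ∀ a ∈ (splitForm V).skewAdjointSubmodule, ∀ x ∈ P, ⁅a, x⁆ ∈ P) :
    P = ⊥ ∨ P = (splitForm V).selfAdjointSubmodule ⊓ LinearMap.ker (LinearMap.trace ℝ (sumDual V)) := by
  classical
  let c := Module.finBasis ℝ V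
  refine OrthogonalSelfAdjointTypeD.eq_bot_or_eq_of_forall_lie_mem_of_toMatrix_eq_JD
    (c.prod (c.dualBasis.map LinearMap.toContinuousLinearMap)) (toMatrix_splitForm_eq_JD V c) ?_ ?_ hP hstab
  · rw [Fintype.card_fin, Nat.cast_ne_zero]
    omega
  · rwa [Fintype.card_fin]

/-- The same with the stability hypothesis phrased over the Lie subalgebra `so V`. [cite: LooijengaLunts1997, Appendix Lemma (7.5), p. 28 L88–L89; §3 (3.3)] -/
theorem splitForm_selfAdjoint_eq_bot_or_eq_of_forall_so_lie_mem (h2 : 2 ≤ finrank ℝ V)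
    {P : Submodule ℝ (Module.End ℝ (sumDual V))}
    (hP : P ≤ (splitForm V).selfAdjointSubmodule ⊓ LinearMap.ker (LinearMap.trace ℝ (sumDual V)))
    (hstab : ∀ a ∈ so V, ∀ x ∈ P, ⁅a, x⁆ ∈ P) :
    P = ⊥ ∨ P = (splitForm V).selfAdjointSubmodule ⊓ LinearMap.ker (LinearMap.trace ℝ (sumDual V)) :=
  splitForm_selfAdjoint_eq_bot_or_eq_of_forall_lie_mem V h2 hP
    fun a ha x hx ↦ hstab a ((mem_so_iff_mem_skewAdjointSubmodule V a).2 ha) x hx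

/-- `𝔤_+(V ⊕ V^*) ≠ 0` for `V ≠ 0`. [cite: LooijengaLunts1997, Appendix Lemma (7.5), p. 28] -/
theorem exists_ne_zero_mem_splitForm_selfAdjoint (h1 : 1 ≤ finrank ℝ V) :
    ∃ x : Module.End ℝ (sumDual V), x ≠ 0
      ∧ x ∈ (splitForm V).selfAdjointSubmodule ⊓ LinearMap.ker (LinearMap.trace ℝ (sumDual V)) := by
  classical
  let c := Module.finBasis ℝ V
  exact OrthogonalSelfAdjointTypeD.exists_ne_zero_mem_selfAdjoint_inf_ker_trace
    (c.prod (c.dualBasis.map LinearMap.toContinuousLinearMap)) (toMatrix_splitForm_eq_JD V c) ⟨0, by omega⟩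

/-- **`[𝔤_+(V ⊕ V^*), 𝔤_+(V ⊕ V^*)] = 𝔰𝔬(V ⊕ V^*)`** for `dim V ≥ 2` (row A1-161's
`span_lie_selfAdjoint_eq_skewAdjointSubmodule`, `dim (V ⊕ V^*) = 2 dim V ≥ 3`). [cite: LooijengaLunts1997, Appendix Lemma (7.5), p. 28 L89–L90 ("If dim U > 2, then [𝔤_+(U), 𝔤_+(U)] = 𝔤_-(U)")] -/
theorem splitForm_span_lie_selfAdjoint_eq_skewAdjointSubmodule (h2 : 2 ≤ finrank ℝ V) :
    Submodule.span ℝ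
        {z | ∃ x ∈ (splitForm V).selfAdjointSubmodule ⊓ LinearMap.ker (LinearMap.trace ℝ (sumDual V)),
          ∃ y ∈ (splitForm V).selfAdjointSubmodule ⊓ LinearMap.ker (LinearMap.trace ℝ (sumDual V)), ⁅x, y⁆ = z} =
      (splitForm V).skewAdjointSubmodule :=
  span_lie_selfAdjoint_eq_skewAdjointSubmodule (splitForm_nondegenerate V) (ε := 1)
    (fun u u' ↦ by rw [one_mul, (splitForm_isSymm V).eq]) (one_mul 1) (by rw [finrank_sumDual]; omega)

/-! ## `dim V = 2`: `𝔰𝔬(V ⊕ V^*) = 𝔰𝔬(2,2)` is semisimple (row A1-180), and the semisimplicity criterion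

Row A1-180 (`OrthogonalSemisimpleTypeDTwo.lean`): for a basis with Gram matrix `JD m K`, `|m| = 2`, the skew-adjoint
algebra has no non-zero abelian ideal, hence (characteristic `0`, Cartan's criterion in Mathlib) is semisimple.  With
the hyperbolic basis of `toMatrix_splitForm_eq_JD` this gives the clause "`𝔤` is semisimple" of "(𝔰𝔬(V ⊕ V^*), u) is a
Jordan–Lefschetz pair" [LooijengaLunts1997, §3 p. 13] also for `dim V = 2`, where `𝔰𝔬(V ⊕ V^*)` is NOT simple
(`not_isSimple_so_of_finrank_eq_two`); altogether **`𝔰𝔬(V ⊕ V^*)` is semisimple iff `dim V ≠ 1`** (`dim V = 0`: the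
zero algebra; `dim V = 1`: `𝔰𝔬(1,1) ≅ ℝ` abelian). -/

/-- `𝔰𝔬(V ⊕ V^*)` is finite-dimensional. [folklore] -/
private theorem moduleFinite_so : Module.Finite ℝ (so V) := by
  letI : LieRing (Module.End ℝ (sumDual V)) := LieRing.ofAssociativeRing
  letI : LieAlgebra ℝ (Module.End ℝ (sumDual V)) := LieAlgebra.ofAssociativeAlgebra
  exact Module.Finite.of_injective (so V).toSubmodule.subtype Subtype.val_injective

/-- **`𝔰𝔬(V ⊕ V^*)` has trivial radical for `dim V = 2`** (`𝔰𝔬(2,2) = D_2`: no non-zero abelian ideal; row A1-180 in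
the hyperbolic basis). [cite: LooijengaLunts1997, §3 p. 13 ("(𝔰𝔬(V ⊕ V^*), u) is a Jordan–Lefschetz pair"); Humphreys1972, §6 Exercise 5(b) p. 30, §1 Exercise 10 p. 6] -/
theorem hasTrivialRadical_so_of_finrank_eq_two (h2 : finrank ℝ V = 2) : LieAlgebra.HasTrivialRadical ℝ (so V) := by
  classical
  have hb := toMatrix_splitForm_eq_JD V (Module.finBasis ℝ V)
  have ha : (⟨0, by omega⟩ : Fin (finrank ℝ V)) ≠ ⟨1, by omega⟩ := by simp
  have hl : ∀ x : Fin (finrank ℝ V), x = ⟨0, by omega⟩ ∨ x = ⟨1, by omega⟩ := by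
    rintro ⟨i, hi⟩
    simp only [Fin.mk.injEq]
    omega
  show LieAlgebra.HasTrivialRadical ℝ (skewAdjointLieSubalgebra (splitForm V))
  exact OrthogonalSemisimpleTypeDTwo.hasTrivialRadical_skewAdjoint_of_toMatrix_eq_JD _ hb ha hl

/-- **`𝔰𝔬(V ⊕ V^*)` is semisimple for `dim V = 2`** (semisimple, not simple). [cite: LooijengaLunts1997, §3 p. 13; Humphreys1972, §6 Exercise 5(b) p. 30, §1 Exercise 10 p. 6] -/
theorem isSemisimple_so_of_finrank_eq_two (h2 : finrank ℝ V = 2) : LieAlgebra.IsSemisimple ℝ (so V) := by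
  haveI := moduleFinite_so V
  haveI := hasTrivialRadical_so_of_finrank_eq_two V h2
  infer_instance

/-- **`𝔰𝔬(V ⊕ V^*)` is semisimple for every `dim V ≥ 2`** — the printed clause "`𝔤` is semisimple" of
"(𝔰𝔬(V ⊕ V^*), u) is a Jordan–Lefschetz pair" (simple for `dim V ≥ 3`, `isSimple_so_of_finrank`; `D_2` for `dim V = 2`).
[cite: LooijengaLunts1997, §3 p. 13 (after (3.2)), (2.2)] -/
theorem isSemisimple_so_of_two_le_finrank (h2 : 2 ≤ finrank ℝ V) : LieAlgebra.IsSemisimple ℝ (so V) := by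
  rcases Nat.eq_or_lt_of_le h2 with h | h
  · exact isSemisimple_so_of_finrank_eq_two V h.symm
  · exact isSemisimple_so_of_finrank V h

/-- `𝔰𝔬(V ⊕ V^*)` has trivial radical for every `dim V ≥ 2`. [cite: LooijengaLunts1997, §3 p. 13, (2.2)] -/
theorem hasTrivialRadical_so_of_two_le_finrank (h2 : 2 ≤ finrank ℝ V) : LieAlgebra.HasTrivialRadical ℝ (so V) :=
  @LieAlgebra.IsSemisimple.instHasTrivialRadical ℝ (so V) _ _ _ (isSemisimple_so_of_two_le_finrank V h2)

/-- `𝔰𝔬(V ⊕ V^*)` has trivial centre for every `dim V ≥ 2`. [cite: LooijengaLunts1997, §3 p. 13, (2.2)] -/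
theorem center_so_eq_bot_of_two_le_finrank (h2 : 2 ≤ finrank ℝ V) : LieAlgebra.center ℝ (so V) = ⊥ := by
  have h := hasTrivialRadical_so_of_two_le_finrank V h2
  exact le_bot_iff.mp ((LieAlgebra.center_le_radical ℝ (so V)).trans_eq h.radical_eq_bot)

/-- **Sharpness at `dim V = 1`**: `𝔰𝔬(1,1) ≅ ℝ` is abelian and non-zero, hence NOT semisimple.
[cite: LooijengaLunts1997, §3 (3.1); Humphreys1972, §1 Exercise 10 p. 6 ("D_1 is the one dimensional Lie algebra")] -/
theorem not_isSemisimple_so_of_finrank_eq_one (h1 : finrank ℝ V = 1) : ¬LieAlgebra.IsSemisimple ℝ (so V) := by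
  intro h
  haveI : IsLieAbelian (so V) := so_isLieAbelian_of_finrank_le_one V h1.le
  have hsub : Subsingleton (so V) := LieAlgebra.subsingleton_of_hasTrivialRadical_lie_abelian ℝ (so V)
  have h0 : finrank ℝ (so V) = 0 := Module.finrank_zero_of_subsingleton
  rw [finrank_so, h1] at h0
  exact absurd h0 (by decide)

/-- The zero algebra `𝔰𝔬(0,0)` (`dim V = 0`) is semisimple in Mathlib's sense (vacuously). [folklore] [cite: LooijengaLunts1997, §3 (3.1)] -/
theorem isSemisimple_so_of_finrank_eq_zero (h0 : finrank ℝ V = 0) : LieAlgebra.IsSemisimple ℝ (so V) := by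
  haveI := moduleFinite_so V
  have hs : finrank ℝ (so V) = 0 := by rw [finrank_so, h0]; decide
  haveI : Subsingleton (so V) := Module.finrank_zero_iff.1 hs
  infer_instance

/-- **`𝔰𝔬(V ⊕ V^*)` is semisimple iff `dim V ≠ 1`.** [cite: LooijengaLunts1997, §3 p. 13, (2.2); Humphreys1972, §1 Exercise 10 p. 6, §6 Exercise 5(b) p. 30] -/
theorem isSemisimple_so_iff : LieAlgebra.IsSemisimple ℝ (so V) ↔ finrank ℝ V ≠ 1 := by
  refine ⟨fun h h1 ↦ not_isSemisimple_so_of_finrank_eq_one V h1 h, fun h ↦ ?_⟩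
  rcases Nat.lt_or_ge (finrank ℝ V) 2 with hlt | hge
  · exact isSemisimple_so_of_finrank_eq_zero V (by omega)
  · exact isSemisimple_so_of_two_le_finrank V hge

/-! ## `dim V = 1`: the summand `𝔤_+(V ⊕ V^*)` is reducible (the hyperbolic plane, row A1-167), and the criterion

For `dim V = 1`, `V ⊕ V^*` is the hyperbolic PLANE — Looijenga–Lunts' excluded case "`U` an inner product space of
dimension two" of (7.5): `𝔰𝔬(1,1) ≅ ℝ` and the `2`-dimensional `𝔤_+ = Sym²₀` splits into two stable lines (row A1-167,
`SplitOrthogonalFour.exists_proper_stable_submodule_selfAdjoint_of_plane`, applied in the reindexed hyperbolic basis with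
Gram matrix `!![0, 1; 1, 0]`).  Hence `𝔤_+(V ⊕ V^*)` is `ad(𝔰𝔬(V ⊕ V^*))`-irreducible iff `dim V ≠ 1`. -/

/-- For `dim V = 1`, a basis of `V ⊕ V^*` indexed by `Fin 2` with Gram matrix `(0 1; 1 0)` (the hyperbolic pair
`(e, e^*)`). [cite: LooijengaLunts1997, §3 (3.1); Humphreys1972, §1.2 p. 3 (type D_ℓ, ℓ = 1)] -/
theorem exists_basis_toMatrix_splitForm_eq_of_finrank_eq_one (h1 : finrank ℝ V = 1) :
    ∃ b : Basis (Fin 2) ℝ (sumDual V), LinearMap.BilinForm.toMatrix b (splitForm V) = !![0, 1; 1, 0] := by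
  classical
  let c : Basis (Fin 1) ℝ V := (Module.finBasis ℝ V).reindex (finCongr h1)
  let bb := c.prod (c.dualBasis.map LinearMap.toContinuousLinearMap)
  have hbb := toMatrix_splitForm_eq_JD V c
  let e : Fin 1 ⊕ Fin 1 ≃ Fin 2 := finSumFinEquiv
  refine ⟨bb.reindex e, ?_⟩
  ext i j
  rw [LinearMap.BilinForm.toMatrix_apply, Basis.reindex_apply, Basis.reindex_apply,
    ← LinearMap.BilinForm.toMatrix_apply bb (splitForm V), hbb]
  have e0 : e.symm (0 : Fin 2) = Sum.inl (0 : Fin 1) := by decide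
  have e1 : e.symm (1 : Fin 2) = Sum.inr (0 : Fin 1) := by decide
  fin_cases i <;> fin_cases j <;> simp [e0, e1, JD]

/-- **Sharpness of `splitForm_selfAdjoint_eq_bot_or_eq_of_forall_lie_mem` at `dim V = 1`**: the summand `𝔤_+(V ⊕ V^*)`
(traceless `S`-self-adjoint operators of the hyperbolic plane) HAS a proper non-zero `ad(𝔰𝔬(V ⊕ V^*))`-stable real
subspace — row A1-167 in the hyperbolic basis.  This is the excluded case "`U` an inner product space of dimension two"
of (7.5). [cite: LooijengaLunts1997, Appendix Lemma (7.5), p. 28 L86–L91; §3 (3.1)] -/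
theorem exists_proper_stable_submodule_splitForm_selfAdjoint_of_finrank_eq_one (h1 : finrank ℝ V = 1) :
    ∃ I : Submodule ℝ (Module.End ℝ (sumDual V)), I ≠ ⊥ ∧
      I < (splitForm V).selfAdjointSubmodule ⊓ LinearMap.ker (LinearMap.trace ℝ (sumDual V)) ∧
      ∀ a ∈ (splitForm V).skewAdjointSubmodule, ∀ x ∈ I, ⁅a, x⁆ ∈ I := by
  obtain ⟨b, hb⟩ := exists_basis_toMatrix_splitForm_eq_of_finrank_eq_one V h1
  exact SplitOrthogonalFour.exists_proper_stable_submodule_selfAdjoint_of_plane hb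

/-- For `dim V = 1` the "`⊥` or everything" alternative for `ad(𝔰𝔬)`-stable subspaces of `𝔤_+(V ⊕ V^*)` FAILS.
[cite: LooijengaLunts1997, Appendix Lemma (7.5), p. 28 L86–L91] -/
theorem not_forall_splitForm_selfAdjoint_eq_bot_or_eq_of_finrank_eq_one (h1 : finrank ℝ V = 1) :
    ¬∀ P : Submodule ℝ (Module.End ℝ (sumDual V)),
      P ≤ (splitForm V).selfAdjointSubmodule ⊓ LinearMap.ker (LinearMap.trace ℝ (sumDual V)) →
      (∀ a ∈ (splitForm V).skewAdjointSubmodule, ∀ x ∈ P, ⁅a, x⁆ ∈ P) →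
      P = ⊥ ∨ P = (splitForm V).selfAdjointSubmodule ⊓ LinearMap.ker (LinearMap.trace ℝ (sumDual V)) := by
  intro h
  obtain ⟨I, hI0, hIlt, hIst⟩ := exists_proper_stable_submodule_splitForm_selfAdjoint_of_finrank_eq_one V h1
  rcases h I hIlt.le hIst with h0 | h2
  · exact hI0 h0
  · exact hIlt.ne h2

/-- For `dim V = 0` every subspace of `End(V ⊕ V^*) = 0` is `⊥`. [folklore] [cite: LooijengaLunts1997, §3 (3.1)] -/
theorem submodule_end_sumDual_eq_bot_of_finrank_eq_zero (h0 : finrank ℝ V = 0)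
    (P : Submodule ℝ (Module.End ℝ (sumDual V))) : P = ⊥ := by
  have hs : finrank ℝ (sumDual V) = 0 := by rw [finrank_sumDual, h0]
  haveI : Subsingleton (sumDual V) := Module.finrank_zero_iff.1 hs
  haveI : Subsingleton (Module.End ℝ (sumDual V)) :=
    ⟨fun f g ↦ LinearMap.ext fun v ↦ Subsingleton.elim _ _⟩
  exact Subsingleton.elim _ _

/-- **The summand `𝔤_+(V ⊕ V^*)` of Looijenga–Lunts (7.5) is `ad(𝔰𝔬(V ⊕ V^*))`-irreducible iff `dim V ≠ 1`**
(`dim V ≥ 2`: rows A1-174/175/177; `dim V = 1`: the reducible hyperbolic plane, row A1-167; `dim V = 0`: vacuous).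
[cite: LooijengaLunts1997, Appendix Lemma (7.5), p. 28 L86–L91 ("Suppose that U is not an inner product space of dimension two … The summands are irreducible")] -/
theorem forall_splitForm_selfAdjoint_eq_bot_or_eq_iff :
    (∀ P : Submodule ℝ (Module.End ℝ (sumDual V)),
      P ≤ (splitForm V).selfAdjointSubmodule ⊓ LinearMap.ker (LinearMap.trace ℝ (sumDual V)) →
      (∀ a ∈ (splitForm V).skewAdjointSubmodule, ∀ x ∈ P, ⁅a, x⁆ ∈ P) →
      P = ⊥ ∨ P = (splitForm V).selfAdjointSubmodule ⊓ LinearMap.ker (LinearMap.trace ℝ (sumDual V)))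
      ↔ finrank ℝ V ≠ 1 := by
  refine ⟨fun h h1 ↦ not_forall_splitForm_selfAdjoint_eq_bot_or_eq_of_finrank_eq_one V h1 h, fun h P hP hstab ↦ ?_⟩
  rcases Nat.lt_or_ge (finrank ℝ V) 2 with hlt | hge
  · exact Or.inl (submodule_end_sumDual_eq_bot_of_finrank_eq_zero V (by omega) P)
  · exact splitForm_selfAdjoint_eq_bot_or_eq_of_forall_lie_mem V hge hP hstab

/-! ## `dim V = 2`: the `ad`-stable subspaces of `𝔰𝔬(V ⊕ V^*) = 𝔰𝔬(2,2)` are exactly `0`, `I_+`, `I_-`, `𝔰𝔬(2,2)` (row A1-183)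

Row A1-183 (`SplitOrthogonalFourStableSubspaces.lean`, Humphreys §5.2 Corollary for `D_2 = A_1 × A_1`) in the hyperbolic
basis of `V ⊕ V^*` indexed by `Fin 2 ⊕ Fin 2`: the summand `𝔤_-(V ⊕ V^*) = 𝔰𝔬(V ⊕ V^*)` of (7.5) is reducible for
`dim V = 2` (`not_isSimple_so_of_finrank_eq_two`), but its only proper non-zero `ad`-stable subspaces are the two commuting
MINIMAL `3`-dimensional ideals. -/

/-- For `dim V = 2`, a basis of `V ⊕ V^*` indexed by `Fin 2 ⊕ Fin 2` with Gram matrix `(0 I; I 0)`.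
[cite: LooijengaLunts1997, §3 (3.1); Humphreys1972, §1.2 p. 4 (type D_ℓ)] -/
theorem exists_basis_toMatrix_splitForm_eq_of_finrank_eq_two (h2 : finrank ℝ V = 2) :
    ∃ b : Basis (Fin 2 ⊕ Fin 2) ℝ (sumDual V),
      LinearMap.BilinForm.toMatrix b (splitForm V) = Matrix.fromBlocks 0 1 1 0 := by
  classical
  let c : Basis (Fin 2) ℝ V := (Module.finBasis ℝ V).reindex (finCongr h2)
  exact ⟨c.prod (c.dualBasis.map LinearMap.toContinuousLinearMap), (toMatrix_splitForm_eq_JD V c).trans rfl⟩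

/-- **The `ad(𝔰𝔬(V ⊕ V^*))`-stable subspaces of `𝔰𝔬(V ⊕ V^*)` for `dim V = 2` are exactly `0`, `I_+`, `I_-` and
`𝔰𝔬(V ⊕ V^*)`**, with `I_± ` two commuting `3`-dimensional `ad`-stable subspaces, `I_+ ⊕ I_- = 𝔰𝔬(V ⊕ V^*)` (rows
A1-165/183: `𝔰𝔬(2,2) ≅ 𝔰𝔩₂(ℝ) × 𝔰𝔩₂(ℝ)` with simple factors; Humphreys §5.2 Corollary).
[cite: LooijengaLunts1997, Appendix Lemma (7.5), p. 28 L89–L90 (the exception dim U = 4), §3 p. 13; Humphreys1972, §5.2 Theorem and Corollary p. 23; FultonHarris1991, §18.2 (18.6) p. 274] -/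
theorem splitForm_stable_submodule_classification_of_finrank_eq_two (h2 : finrank ℝ V = 2) :
    ∃ I J : Submodule ℝ (Module.End ℝ (sumDual V)), I ⊔ J = (splitForm V).skewAdjointSubmodule ∧ I ⊓ J = ⊥ ∧
      finrank ℝ I = 3 ∧ finrank ℝ J = 3 ∧ (∀ x ∈ I, ∀ y ∈ J, ⁅x, y⁆ = 0) ∧
      (∀ a ∈ (splitForm V).skewAdjointSubmodule, ∀ x ∈ I, ⁅a, x⁆ ∈ I) ∧
      (∀ a ∈ (splitForm V).skewAdjointSubmodule, ∀ y ∈ J, ⁅a, y⁆ ∈ J) ∧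
      ∀ P : Submodule ℝ (Module.End ℝ (sumDual V)), P ≤ (splitForm V).skewAdjointSubmodule →
        (∀ a ∈ (splitForm V).skewAdjointSubmodule, ∀ x ∈ P, ⁅a, x⁆ ∈ P) →
        P = ⊥ ∨ P = I ∨ P = J ∨ P = (splitForm V).skewAdjointSubmodule := by
  obtain ⟨b, hb⟩ := exists_basis_toMatrix_splitForm_eq_of_finrank_eq_two V h2
  exact SplitOrthogonalFourStable.stable_submodule_classification hb

/-- For `dim V = 2` the two commuting ideals of `𝔰𝔬(V ⊕ V^*)` are MINIMAL (`ad`-irreducible).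
[cite: Humphreys1972, §5.2 Theorem p. 23, §1 Exercise 10 p. 6 (D_2); FultonHarris1991, §18.2 (18.6) p. 274] -/
theorem splitForm_exists_commuting_minimal_ideals_of_finrank_eq_two (h2 : finrank ℝ V = 2) :
    ∃ I J : Submodule ℝ (Module.End ℝ (sumDual V)), I ⊔ J = (splitForm V).skewAdjointSubmodule ∧ I ⊓ J = ⊥ ∧
      (∀ x ∈ I, ∀ y ∈ J, ⁅x, y⁆ = 0) ∧
      (∀ P : Submodule ℝ (Module.End ℝ (sumDual V)), P ≤ I →
        (∀ a ∈ (splitForm V).skewAdjointSubmodule, ∀ x ∈ P, ⁅a, x⁆ ∈ P) → P = ⊥ ∨ P = I) ∧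
      (∀ P : Submodule ℝ (Module.End ℝ (sumDual V)), P ≤ J →
        (∀ a ∈ (splitForm V).skewAdjointSubmodule, ∀ x ∈ P, ⁅a, x⁆ ∈ P) → P = ⊥ ∨ P = J) := by
  obtain ⟨b, hb⟩ := exists_basis_toMatrix_splitForm_eq_of_finrank_eq_two V h2
  exact SplitOrthogonalFourStable.exists_commuting_minimal_ideals hb

/-- **A proper non-zero `ad`-stable subspace of `𝔰𝔬(V ⊕ V^*)`, `dim V = 2`, has dimension `3`.**
[cite: Humphreys1972, §5.2 Corollary p. 23; FultonHarris1991, §18.2 (18.6) p. 274] -/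
theorem splitForm_finrank_eq_three_of_stable_of_finrank_eq_two (h2 : finrank ℝ V = 2)
    {P : Submodule ℝ (Module.End ℝ (sumDual V))} (hP : P ≤ (splitForm V).skewAdjointSubmodule)
    (hstab : ∀ a ∈ (splitForm V).skewAdjointSubmodule, ∀ x ∈ P, ⁅a, x⁆ ∈ P) (h0 : P ≠ ⊥)
    (h1 : P ≠ (splitForm V).skewAdjointSubmodule) : finrank ℝ P = 3 := by
  obtain ⟨b, hb⟩ := exists_basis_toMatrix_splitForm_eq_of_finrank_eq_two V h2
  exact SplitOrthogonalFourStable.finrank_eq_three_of_stable hb hP hstab h0 h1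

/-! ## `dim V = 2`: the Lie ideals of `𝔰𝔬(V ⊕ V^*) = 𝔰𝔬(2,2)` are `⊥`, `I₁`, `I₂`, `⊤` with `I₁, I₂` simple (row A1-185)

At the level of Mathlib Lie ideals of the Lie algebra `so V` (row A1-185 in the hyperbolic basis): `𝔰𝔬(2,2)` is the
direct sum of two commuting SIMPLE ideals (`≅ 𝔰𝔩₂(ℝ) × 𝔰𝔩₂(ℝ)`, the real form of `D_2 = A_1 × A_1`), and these,
`⊥` and `⊤` are all its ideals — Humphreys' §5.2 structure theorem made explicit in the one dimension where
`𝔰𝔬(V ⊕ V^*)` is semisimple but not simple. -/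

/-- **The Lie ideals of `𝔰𝔬(V ⊕ V^*)` for `dim V = 2` are exactly `⊥`, `I₁`, `I₂`, `⊤`**, `I₁, I₂` commuting atoms with
`I₁ ⊓ I₂ = ⊥`, `I₁ ⊔ I₂ = ⊤`. [cite: Humphreys1972, §5.2 Theorem and Corollary p. 23, §1 Exercise 10 p. 6 (D_2); LooijengaLunts1997, §3 p. 13, Appendix (7.5) p. 28 L89–L90; FultonHarris1991, §18.2 (18.6) p. 274] -/
theorem so_lieIdeal_classification_of_finrank_eq_two (h2 : finrank ℝ V = 2) :
    ∃ I₁ I₂ : LieIdeal ℝ (so V), I₁ ⊓ I₂ = ⊥ ∧ I₁ ⊔ I₂ = ⊤ ∧ (∀ x ∈ I₁, ∀ y ∈ I₂, ⁅x, y⁆ = 0) ∧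
      IsAtom I₁ ∧ IsAtom I₂ ∧ ∀ N : LieIdeal ℝ (so V), N = ⊥ ∨ N = I₁ ∨ N = I₂ ∨ N = ⊤ := by
  obtain ⟨b, hb⟩ := exists_basis_toMatrix_splitForm_eq_of_finrank_eq_two V h2
  exact SplitOrthogonalFourStable.lieIdeal_classification hb

/-- **`𝔰𝔬(V ⊕ V^*) = I₁ ⊕ I₂` with `I₁, I₂` SIMPLE real Lie algebras for `dim V = 2`** (`𝔰𝔬(2,2) ≅ 𝔰𝔩₂(ℝ) × 𝔰𝔩₂(ℝ)`;
the isomorphism with `𝔰𝔩₂` is not constructed). [cite: Humphreys1972, §5.2 Theorem p. 23, §1 Exercise 10 p. 6; LooijengaLunts1997, §3 p. 13; FultonHarris1991, §18.2 (18.6) p. 274] -/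
theorem so_exists_isSimple_ideals_of_finrank_eq_two (h2 : finrank ℝ V = 2) :
    ∃ I₁ I₂ : LieIdeal ℝ (so V), I₁ ⊓ I₂ = ⊥ ∧ I₁ ⊔ I₂ = ⊤ ∧ (∀ x ∈ I₁, ∀ y ∈ I₂, ⁅x, y⁆ = 0) ∧
      LieAlgebra.IsSimple ℝ I₁ ∧ LieAlgebra.IsSimple ℝ I₂ ∧
      ∀ N : LieIdeal ℝ (so V), N = ⊥ ∨ N = I₁ ∨ N = I₂ ∨ N = ⊤ := by
  obtain ⟨b, hb⟩ := exists_basis_toMatrix_splitForm_eq_of_finrank_eq_two V h2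
  exact SplitOrthogonalFourStable.exists_isSimple_ideals hb

/-- For `dim V = 2`, a non-trivial proper Lie ideal of `𝔰𝔬(V ⊕ V^*)` is a simple Lie algebra of dimension `3`.
[cite: Humphreys1972, §5.2 Theorem p. 23, §1 Exercise 10 p. 6; FultonHarris1991, §18.2 (18.6) p. 274] -/
theorem so_isSimple_lieIdeal_of_finrank_eq_two (h2 : finrank ℝ V = 2) {N : LieIdeal ℝ (so V)} (h0 : N ≠ ⊥)
    (h1 : N ≠ ⊤) : LieAlgebra.IsSimple ℝ N := by
  obtain ⟨I₁, I₂, -, -, -, hs1, hs2, hcl⟩ := so_exists_isSimple_ideals_of_finrank_eq_two V h2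
  rcases hcl N with h | h | h | h
  · exact absurd h h0
  · rw [h]; exact hs1
  · rw [h]; exact hs2
  · exact absurd h h1

end Literature.LinearAlgebra.Alternating
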